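import Summits.HodgeConjecture.HodgeConjecture.Theorems.F0P6aKottwitzCountAtSplitPlace   -- ★ p847313: the `(τR, hτR)` currency, `ker_residue_restrict_structural`, `c`-costume lemmas
import Literature.NumberTheory.ComplexMultiplication.CMTypePrimeProductFrobeniusShape      -- ★ (C2-arith) p846565: `exists_frobeniusShape_prod_smul_asIdeal_complexConj`
import Literature.AlgebraicGeometry.ComplexMultiplication.GaloisOcticStabiliserLemma       -- ★ `complexConj_mul_comm` (`c` central in `Gal(F∕ℚ)`)
import Mathlib.FieldTheory.Normal.Basic
import HarnessLib

/-!
# Embeddings `F →+* F̄_w` as a `Gal(F∕ℚ)`-torsor, and the places they induce (GEN heir A-p18 (g32); crux hLiu418 `--supports`)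

Cell `hodgecm-mathlib` (D-0151), P6 «MOD programme», crux `stmt-HodgeConjecture-24832` (hLiu418).  THEOREMS ONLY (no definition, no instance, no
notation, no named fact, no `sorry`).  HC_CM is proved only modulo the 7 printed citations (2 remaining named inputs hLiu418 24832, h413 24833) until
rung 0 closes; nothing here is about HC.

PURPOSE.  The spine `Cruxes/HLiu418/Lines/F0_P6a_RGDAssembly.lean` (ED. 3) reads the Kottwitz signature of the localised PEL tuple in the (K-Ω) currency
`m : (F →+* Ω) → ℕ`, `Ω = F̄_w := AlgebraicClosure (w.adicCompletion F)`, with «`τ` induces the place `v`» spelled `ker (residue ∘ τR τ) = 𝔭_v` for the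
restrictions `τR τ : 𝓞 F →+* R` to the valuation ring (rows `τR`, `τR_spec`, `m_count`; ★ p847313).  The arithmetic of the twist ideals ((C2-arith) ★
`CMTypePrimeProductFrobeniusShape`, p846565) is written in the currency `Ψ : Finset (F ≃ₐ[ℚ] F)`, `∏ g ∈ Ψ, 𝔭_{g • w}`, `Stab(w) ⊆ Ψ`, `Ψ ∩ c̃Ψ = ∅`.  This file is
the BRIDGE, for `F ∕ ℚ` Galois:
* §1 TORSOR: every embedding `τ : F →+* Ω` is `τ_w ∘ g` for a UNIQUE `g ∈ Gal(F∕ℚ)`, where `τ_w : F → F_w → F̄_w` is the structural embedding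
  (`exists_algEquiv_eq_structural_comp`, `structural_comp_injective`, `existsUnique_algEquiv_eq_structural_comp`);
* §2 PLACES: `τ_w ∘ g` induces `g⁻¹ • w` — `ker (residue ∘ τR (τ_w ∘ g)) = 𝔭_{g⁻¹ • w}` (`ker_residue_restrict_structural_comp_algEquiv`), hence «`τ_w ∘ g` induces
  `v` ↔ `g⁻¹ • w = v`», «induces `w` ↔ `g ∈ Stab(w)`», and the `c`-costume `(τ_w ∘ g) ∘ c = τ_w ∘ (c̃ * g)` (`c̃` central, ★ `complexConj_mul_comm`);
* §3 DICTIONARY: sums ∕ products over a filter of embeddings = sums ∕ products over the corresponding filter of `Gal(F∕ℚ)` (`sum_filter_embeddings_eq`,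
  `prod_filter_embeddings_eq`);
* §4 THE HALF-TYPE OF A SIGNATURE: for `m` with `m τ + m (τ ∘ c) = 2`, the count `∑_{τ ↦ c•w} m τ = 1` (the spine՚s `m_count`) and the banal law «`m = 1` only
  at embeddings inducing `w` or `c•w`» (GEN memo `MEMO-FPIN-spineED4` §5 (B-1); not in the spine ED. 3, true for door (E)՚s `mOf` by definition), the set
  `Ψ(m) := {g | m (τ_w ∘ g) ≠ 0 ∧ τ_w ∘ g ∤ c•w}` satisfies the two hypotheses `hD` (`Stab(w) ⊆ Ψ`) and `hc` (`g ∈ Ψ → c̃ g ∉ Ψ`) of ★ (C2-arith) — so the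
  CM-type product `∏ g ∈ Ψ(m), 𝔭_{g • w}` has the Frobenius shape `𝔭_w^{d_w}·𝔟`, `𝔟 ⊥ 𝔭_w, 𝔭_{c•w}`, `q ∈ 𝔞` (`signature_ne_zero_of_ker_eq`,
  `exists_frobeniusShape_halfTypeOfSignature`).
USE: the «canonical twist ideal» of a Frobenius-reading `γ` read from `I.m` (L3 `stub_FROB` roads; GEN memo `MEMO-FPIN-spineED4`), in either direction of LEAD
«M-54».  [cite: CasselsFrohlichANT1967, Ch. VII §1.1 and Prop. 1.2 (ii)] [cite: NeukirchANT1999, Ch. II (8.1), (9.1)] [cite: Shimura1998, §13.1 Thm. 1 and (7); §18.2 Lemma (i)]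
-/

set_option autoImplicit false

-- `Summit.HodgeConjecture.HodgeConjecture.…` repeats `HodgeConjecture` by design (D-0017).
set_option linter.dupNamespace false

noncomputable section

open NumberField IsDedekindDomain IsLocalRing
open scoped Pointwise
open Literature.NumberTheory.GaloisRepresentations (closureValuationSubring)
open Literature.NumberTheory.Automorphic
open Summit.HodgeConjecture.HodgeConjecture.Theorems.F0P6aKottwitzCountAtSplitPlace

namespace Summit.HodgeConjecture.HodgeConjecture.Theorems.F0P6aEmbeddingTorsorPlaces

variable {F : Type} [Field F] [NumberField F] (w : HeightOneSpectrum (𝓞 F))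

/-! ### §1 The embeddings `F →+* F̄_w` form a `Gal(F∕ℚ)`-torsor through the structural embedding `τ_w` -/

/-- **Every embedding is a Galois translate of the structural one** (`F ∕ ℚ` normal): `τ = τ_w ∘ g` for some `g ∈ Gal(F∕ℚ)` — Mathlib՚s
`AlgHom.restrictNormal'` of `τ` viewed over the `F`-algebra `F̄_w` structured by `τ_w`. [cite: CasselsFrohlichANT1967, Ch. VII §1.1] -/
theorem exists_algEquiv_eq_structural_comp [IsGalois ℚ F] (τ : F →+* AlgebraicClosure (w.adicCompletion F)) :
    ∃ g : F ≃ₐ[ℚ] F,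
      τ = ((algebraMap (w.adicCompletion F) (AlgebraicClosure (w.adicCompletion F))).comp (algebraMap F (w.adicCompletion F))).comp
        (g : F →+* F) := by
  -- `F̄_w` is an `F`-algebra through `τ_w` (Mathlib՚s tower instance on `AlgebraicClosure`), and a `ℚ`-tower
  haveI : IsScalarTower ℚ F (AlgebraicClosure (w.adicCompletion F)) :=
    IsScalarTower.of_algebraMap_eq (R := ℚ) (S := F) (A := AlgebraicClosure (w.adicCompletion F)) fun x => by
      simp only [eq_ratCast, map_ratCast]
  have hτw : algebraMap F (AlgebraicClosure (w.adicCompletion F)) =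
      (algebraMap (w.adicCompletion F) (AlgebraicClosure (w.adicCompletion F))).comp (algebraMap F (w.adicCompletion F)) :=
    IsScalarTower.algebraMap_eq F (w.adicCompletion F) (AlgebraicClosure (w.adicCompletion F))
  let φ : F →ₐ[ℚ] AlgebraicClosure (w.adicCompletion F) := τ.toRatAlgHom
  refine ⟨φ.restrictNormal' F, RingHom.ext fun x => ?_⟩
  have h := AlgHom.restrictNormal_commutes φ F x
  rw [Algebra.algebraMap_self_apply, hτw] at h
  exact h.symm

/-- **Uniqueness**: `g ↦ τ_w ∘ g` is injective (`τ_w` is injective, being a ring map out of a field). [cite: CasselsFrohlichANT1967, Ch. VII §1.1] -/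
theorem structural_comp_injective :
    Function.Injective fun g : F ≃ₐ[ℚ] F =>
      ((algebraMap (w.adicCompletion F) (AlgebraicClosure (w.adicCompletion F))).comp (algebraMap F (w.adicCompletion F))).comp
        (g : F →+* F) := by
  intro g g' h
  refine AlgEquiv.ext fun x => ?_
  have hx := RingHom.congr_fun h x
  exact ((algebraMap (w.adicCompletion F) (AlgebraicClosure (w.adicCompletion F))).comp (algebraMap F (w.adicCompletion F))).injective hx

/-- **The torsor**: `∃! g, τ = τ_w ∘ g`. [cite: CasselsFrohlichANT1967, Ch. VII §1.1] -/
theorem existsUnique_algEquiv_eq_structural_comp [IsGalois ℚ F] (τ : F →+* AlgebraicClosure (w.adicCompletion F)) :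
    ∃! g : F ≃ₐ[ℚ] F,
      τ = ((algebraMap (w.adicCompletion F) (AlgebraicClosure (w.adicCompletion F))).comp (algebraMap F (w.adicCompletion F))).comp
        (g : F →+* F) := by
  obtain ⟨g, hg⟩ := exists_algEquiv_eq_structural_comp w τ
  exact ⟨g, hg, fun g' hg' => structural_comp_injective w (hg'.symm.trans hg)⟩

/-- **`g ↦ τ_w ∘ g` is a bijection `Gal(F∕ℚ) ≃ (F →+* F̄_w)`.** [cite: CasselsFrohlichANT1967, Ch. VII §1.1] -/
theorem structural_comp_bijective [IsGalois ℚ F] :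
    Function.Bijective fun g : F ≃ₐ[ℚ] F =>
      ((algebraMap (w.adicCompletion F) (AlgebraicClosure (w.adicCompletion F))).comp (algebraMap F (w.adicCompletion F))).comp
        (g : F →+* F) :=
  ⟨structural_comp_injective w, fun τ => by
    obtain ⟨g, hg⟩ := exists_algEquiv_eq_structural_comp w τ
    exact ⟨g, hg.symm⟩⟩

/-! ### §2 The place induced by `τ_w ∘ g` is `g⁻¹ • w` (in the `(τR, hτR)` currency of the spine) -/

section Restrict

variable (τR : (F →+* AlgebraicClosure (w.adicCompletion F)) → (𝓞 F →+* ↥(closureValuationSubring (w.adicCompletion F))))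
  (hτR : ∀ (τ : F →+* AlgebraicClosure (w.adicCompletion F)) (x : 𝓞 F),
    ((τR τ x : ↥(closureValuationSubring (w.adicCompletion F))) : AlgebraicClosure (w.adicCompletion F)) = τ (x : F))

include hτR

/-- `τR (τ_w ∘ g) x = τR τ_w (g • x)` (both have underlying value `τ_w (g x)`). [cite: CasselsFrohlichANT1967, Ch. VII §1.1] -/
theorem restrict_structural_comp_algEquiv_apply (g : F ≃ₐ[ℚ] F) (x : 𝓞 F) :
    τR (((algebraMap (w.adicCompletion F) (AlgebraicClosure (w.adicCompletion F))).comp (algebraMap F (w.adicCompletion F))).comp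
        (g : F →+* F)) x =
      τR ((algebraMap (w.adicCompletion F) (AlgebraicClosure (w.adicCompletion F))).comp (algebraMap F (w.adicCompletion F))) (g • x) := by
  apply Subtype.ext
  rw [hτR, hτR]
  rfl

/-- **`τ_w ∘ g` INDUCES `g⁻¹ • w`**: `ker (residue ∘ τR (τ_w ∘ g)) = 𝔭_{g⁻¹ • w}` (`x ↦ τ_w (g x)` lands in the maximal ideal of `R` iff `g x ∈ 𝔭_w`, ★
`ker_residue_restrict_structural`, iff `x ∈ g⁻¹ 𝔭_w`). [cite: CasselsFrohlichANT1967, Ch. VII §1.1] [cite: NeukirchANT1999, Ch. II (8.1), (9.1)] -/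
theorem ker_residue_restrict_structural_comp_algEquiv (g : F ≃ₐ[ℚ] F) :
    RingHom.ker ((residue ↥(closureValuationSubring (w.adicCompletion F))).comp
        (τR (((algebraMap (w.adicCompletion F) (AlgebraicClosure (w.adicCompletion F))).comp (algebraMap F (w.adicCompletion F))).comp
          (g : F →+* F)))) = (g⁻¹ • w).asIdeal := by
  ext x
  rw [RingHom.mem_ker, RingHom.comp_apply, restrict_structural_comp_algEquiv_apply w τR hτR g x, ← RingHom.comp_apply,
    ← RingHom.mem_ker, ker_residue_restrict_structural w τR hτR, HeightOneSpectrum.smul_asIdeal, Ideal.mem_inv_pointwise_smul_iff]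

/-- **«`τ_w ∘ g` induces `v`» ↔ `g⁻¹ • w = v`.** [cite: CasselsFrohlichANT1967, Ch. VII §1.1] -/
theorem ker_residue_restrict_structural_comp_algEquiv_eq_iff (g : F ≃ₐ[ℚ] F) (v : HeightOneSpectrum (𝓞 F)) :
    RingHom.ker ((residue ↥(closureValuationSubring (w.adicCompletion F))).comp
        (τR (((algebraMap (w.adicCompletion F) (AlgebraicClosure (w.adicCompletion F))).comp (algebraMap F (w.adicCompletion F))).comp
          (g : F →+* F)))) = v.asIdeal ↔ g⁻¹ • w = v := by
  rw [ker_residue_restrict_structural_comp_algEquiv w τR hτR g, HeightOneSpectrum.ext_iff]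

/-- **«`τ_w ∘ g` induces `w`» ↔ `g ∈ Stab(w)`.** [cite: CasselsFrohlichANT1967, Ch. VII Prop. 1.2 (ii)] -/
theorem ker_residue_restrict_structural_comp_algEquiv_eq_self_iff (g : F ≃ₐ[ℚ] F) :
    RingHom.ker ((residue ↥(closureValuationSubring (w.adicCompletion F))).comp
        (τR (((algebraMap (w.adicCompletion F) (AlgebraicClosure (w.adicCompletion F))).comp (algebraMap F (w.adicCompletion F))).comp
          (g : F →+* F)))) = w.asIdeal ↔ g • w = w := by
  rw [ker_residue_restrict_structural_comp_algEquiv_eq_iff w τR hτR g w, inv_smul_eq_iff, eq_comm]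

end Restrict

/-- **The `c`-costume**: `(τ_w ∘ g) ∘ c = τ_w ∘ (c̃ * g)` with `c̃ := c.restrictScalars ℚ` — because `c̃` is CENTRAL in `Gal(F∕ℚ)` (★ `complexConj_mul_comm`),
`c̃ * g = g * c̃` and `(g * c̃) x = g (c x)`. [cite: Shimura1998, §18.2 Lemma (i)] -/
theorem structural_comp_algEquiv_comp_complexConj [IsCMField F] [IsGalois ℚ F] (g : F ≃ₐ[ℚ] F) :
    (((algebraMap (w.adicCompletion F) (AlgebraicClosure (w.adicCompletion F))).comp (algebraMap F (w.adicCompletion F))).comp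
        (g : F →+* F)).comp ((IsCMField.complexConj F : F ≃ₐ[↥(maximalRealSubfield F)] F) : F →+* F) =
      ((algebraMap (w.adicCompletion F) (AlgebraicClosure (w.adicCompletion F))).comp (algebraMap F (w.adicCompletion F))).comp
        (((IsCMField.complexConj F).restrictScalars ℚ * g : F ≃ₐ[ℚ] F) : F →+* F) := by
  rw [Literature.AlgebraicGeometry.ComplexMultiplication.GaloisOcticStabiliser.GaloisOctic.complexConj_mul_comm g]
  refine RingHom.ext fun x => ?_
  change _ = ((algebraMap (w.adicCompletion F) (AlgebraicClosure (w.adicCompletion F))).comp (algebraMap F (w.adicCompletion F)))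
    ((g * (IsCMField.complexConj F).restrictScalars ℚ) x)
  rw [AlgEquiv.mul_apply, AlgEquiv.restrictScalars_apply]
  rfl

/-! ### §3 The dictionary: sums and products over filters of embeddings = over filters of `Gal(F∕ℚ)` -/

/-- **Reindexing a filtered SUM over embeddings along the torsor.** [cite: CasselsFrohlichANT1967, Ch. VII §1.1] -/
theorem sum_filter_embeddings_eq [IsGalois ℚ F] {M : Type*} [AddCommMonoid M]
    (P : (F →+* AlgebraicClosure (w.adicCompletion F)) → Prop) [DecidablePred P]
    (f : (F →+* AlgebraicClosure (w.adicCompletion F)) → M) :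
    ∑ τ ∈ Finset.univ.filter P, f τ =
      ∑ g ∈ Finset.univ.filter (fun g : F ≃ₐ[ℚ] F =>
          P (((algebraMap (w.adicCompletion F) (AlgebraicClosure (w.adicCompletion F))).comp (algebraMap F (w.adicCompletion F))).comp
            (g : F →+* F))),
        f (((algebraMap (w.adicCompletion F) (AlgebraicClosure (w.adicCompletion F))).comp (algebraMap F (w.adicCompletion F))).comp
          (g : F →+* F)) := by
  classical
  symm
  refine Finset.sum_equiv (Equiv.ofBijective _ (structural_comp_bijective w)) (fun g => ?_) (fun g _ => rfl)
  simp only [Finset.mem_filter, Finset.mem_univ, true_and, Equiv.ofBijective_apply]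

/-- **Reindexing a filtered PRODUCT over embeddings along the torsor.** [cite: CasselsFrohlichANT1967, Ch. VII §1.1] -/
theorem prod_filter_embeddings_eq [IsGalois ℚ F] {M : Type*} [CommMonoid M]
    (P : (F →+* AlgebraicClosure (w.adicCompletion F)) → Prop) [DecidablePred P]
    (f : (F →+* AlgebraicClosure (w.adicCompletion F)) → M) :
    ∏ τ ∈ Finset.univ.filter P, f τ =
      ∏ g ∈ Finset.univ.filter (fun g : F ≃ₐ[ℚ] F =>
          P (((algebraMap (w.adicCompletion F) (AlgebraicClosure (w.adicCompletion F))).comp (algebraMap F (w.adicCompletion F))).comp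
            (g : F →+* F))),
        f (((algebraMap (w.adicCompletion F) (AlgebraicClosure (w.adicCompletion F))).comp (algebraMap F (w.adicCompletion F))).comp
          (g : F →+* F)) := by
  classical
  symm
  refine Finset.prod_equiv (Equiv.ofBijective _ (structural_comp_bijective w)) (fun g => ?_) (fun g _ => rfl)
  simp only [Finset.mem_filter, Finset.mem_univ, true_and, Equiv.ofBijective_apply]

/-! ### §4 The half-type `Ψ(m)` of a signature with `m τ + m (τ ∘ c) = 2` and `∑_{τ ↦ c•w} m τ = 1`: the hypotheses of ★ (C2-arith) discharged -/

section HalfType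

variable [IsCMField F]
  (τR : (F →+* AlgebraicClosure (w.adicCompletion F)) → (𝓞 F →+* ↥(closureValuationSubring (w.adicCompletion F))))
  (hτR : ∀ (τ : F →+* AlgebraicClosure (w.adicCompletion F)) (x : 𝓞 F),
    ((τR τ x : ↥(closureValuationSubring (w.adicCompletion F))) : AlgebraicClosure (w.adicCompletion F)) = τ (x : F))
  (m : (F →+* AlgebraicClosure (w.adicCompletion F)) → ℕ)
  (hpair : ∀ τ : F →+* AlgebraicClosure (w.adicCompletion F),
    m τ + m (τ.comp ((IsCMField.complexConj F : F ≃ₐ[↥(maximalRealSubfield F)] F) : F →+* F)) = 2)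
  (hcount : ∑ τ ∈ (Finset.univ.filter fun τ : F →+* AlgebraicClosure (w.adicCompletion F) =>
      RingHom.ker ((residue ↥(closureValuationSubring (w.adicCompletion F))).comp (τR τ)) =
        (((IsCMField.complexConj F) • w).asIdeal : Ideal (𝓞 F))), m τ = 1)

include hτR hpair hcount

/-- **At an embedding inducing `w`, `m ≠ 0`** (else its `c`-partner, which induces `c•w` (★ `ker_residue_restrict_comp_complexConj`), would carry `m = 2 > 1 =`
the whole `c•w`-count). [cite: RapoportSmithlingZhang2020Diagonal, §4.1 (4.6) p. 16] -/
theorem signature_ne_zero_of_ker_eq (τ : F →+* AlgebraicClosure (w.adicCompletion F))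
    (hτ : RingHom.ker ((residue ↥(closureValuationSubring (w.adicCompletion F))).comp (τR τ)) = w.asIdeal) : m τ ≠ 0 := by
  classical
  intro h0
  have h2 : m (τ.comp ((IsCMField.complexConj F : F ≃ₐ[↥(maximalRealSubfield F)] F) : F →+* F)) = 2 := by
    have := hpair τ; omega
  -- the partner induces `c • w`
  have hmem : τ.comp ((IsCMField.complexConj F : F ≃ₐ[↥(maximalRealSubfield F)] F) : F →+* F) ∈
      Finset.univ.filter fun τ : F →+* AlgebraicClosure (w.adicCompletion F) =>
        RingHom.ker ((residue ↥(closureValuationSubring (w.adicCompletion F))).comp (τR τ)) =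
          (((IsCMField.complexConj F) • w).asIdeal : Ideal (𝓞 F)) := by
    rw [Finset.mem_filter]
    refine ⟨Finset.mem_univ _, ?_⟩
    rw [ker_residue_restrict_comp_complexConj w τR hτR τ, hτ, HeightOneSpectrum.smul_asIdeal]
  have hle := Finset.single_le_sum (f := m) (fun _ _ => Nat.zero_le _) hmem
  rw [hcount, h2] at hle
  omega

/-- **THE HALF-TYPE OF THE SIGNATURE SATISFIES ★ (C2-arith)՚S TWO HYPOTHESES**, whence the CM-type product `𝔞(m, w) := ∏ g ∈ Ψ(m), 𝔭_{g • w}` over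
`Ψ(m) := {g | m (τ_w ∘ g) ≠ 0 ∧ τ_w ∘ g ∤ c•w}` has the FROBENIUS SHAPE: `𝔞 = 𝔭_w^d · 𝔟` with `𝔟 ⊥ 𝔭_w`, `𝔟 ⊥ 𝔭_{c•w}`, `𝔭_w^d ∥ (N 𝔭_w)`, `N 𝔭_w ∈ 𝔞`.
HYPOTHESES on the signature: `hpair` (`m τ + m (τ ∘ c) = 2`), `hcount` (the spine՚s `m_count`: `∑_{τ ↦ c•w} m τ = 1`), and the BANAL LAW `hone` («`m τ = 1` only at
embeddings inducing `w` or `c•w`» — equivalently `m ∈ {0, 2}` at banal embeddings; NOT derivable from the spine ED. 3, GEN memo `MEMO-FPIN-spineED4` §5 (B-1), true for door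
(E)՚s `mOf` by definition), plus `hw : c•w ≠ w`.  PROOF: `hD` — an element of `Stab(w)` gives an embedding inducing `w` (§2), so `m ≠ 0` by `signature_ne_zero_of_ker_eq`
and it does not induce `c•w ≠ w`; `hc` — the embedding of `c̃ g` is the `c`-partner `(τ_w ∘ g) ∘ c` (`structural_comp_algEquiv_comp_complexConj`), inducing `c •` the place
of `τ_w ∘ g` (★ `ker_residue_restrict_comp_complexConj`): if `m (τ_w ∘ g) = 2` the partner has `m = 0 ∉ Ψ`; if `m (τ_w ∘ g) = 1` then by `hone` and `g ∈ Ψ` the embedding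
`τ_w ∘ g` induces `w`, so the partner induces `c•w ∉ Ψ`. [cite: Shimura1998, §13.1 Thm. 1 and (7)] [cite: RapoportSmithlingZhang2020Diagonal, §4.1 (4.6) p. 16] -/
theorem exists_frobeniusShape_halfTypeOfSignature [IsGalois ℚ F] (hw : (IsCMField.complexConj F) • w ≠ w)
    (hone : ∀ τ : F →+* AlgebraicClosure (w.adicCompletion F), m τ = 1 →
      RingHom.ker ((residue ↥(closureValuationSubring (w.adicCompletion F))).comp (τR τ)) = w.asIdeal ∨
        RingHom.ker ((residue ↥(closureValuationSubring (w.adicCompletion F))).comp (τR τ)) = ((IsCMField.complexConj F) • w).asIdeal) :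
    letI Ψ : Finset (F ≃ₐ[ℚ] F) := Finset.univ.filter fun g : F ≃ₐ[ℚ] F =>
      m (((algebraMap (w.adicCompletion F) (AlgebraicClosure (w.adicCompletion F))).comp (algebraMap F (w.adicCompletion F))).comp
          (g : F →+* F)) ≠ 0 ∧
        RingHom.ker ((residue ↥(closureValuationSubring (w.adicCompletion F))).comp
          (τR (((algebraMap (w.adicCompletion F) (AlgebraicClosure (w.adicCompletion F))).comp (algebraMap F (w.adicCompletion F))).comp
            (g : F →+* F)))) ≠ ((IsCMField.complexConj F) • w).asIdeal
    ∃ (𝔟 : Ideal (𝓞 F)) (d : ℕ),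
      𝔟 ⊔ w.asIdeal = ⊤ ∧ 𝔟 ⊔ ((IsCMField.complexConj F) • w).asIdeal = ⊤ ∧
      ∏ g ∈ Ψ, (g • w).asIdeal = w.asIdeal ^ d * 𝔟 ∧
      w.asIdeal ^ d ∣ Ideal.span {((Ideal.absNorm w.asIdeal : ℕ) : 𝓞 F)} ∧
      ¬ w.asIdeal ^ (d + 1) ∣ Ideal.span {((Ideal.absNorm w.asIdeal : ℕ) : 𝓞 F)} ∧
      ((Ideal.absNorm w.asIdeal : ℕ) : 𝓞 F) ∈ ∏ g ∈ Ψ, (g • w).asIdeal := by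
  classical
  refine Literature.NumberTheory.ComplexMultiplication.exists_frobeniusShape_prod_smul_asIdeal_complexConj _ w ?_ ?_
  · -- `hD`: `Stab(w) ⊆ Ψ`
    intro g hg
    rw [Finset.mem_filter]
    have hker := (ker_residue_restrict_structural_comp_algEquiv_eq_self_iff w τR hτR g).2 hg
    refine ⟨Finset.mem_univ _, signature_ne_zero_of_ker_eq w τR hτR m hpair hcount _ hker, ?_⟩
    rw [hker]
    exact fun h => hw (HeightOneSpectrum.ext h).symm
  · -- `hc`: `g ∈ Ψ → c̃ g ∉ Ψ`
    intro g hg hcg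
    rw [Finset.mem_filter] at hg hcg
    obtain ⟨-, hm, hnc⟩ := hg
    obtain ⟨-, hm', hnc'⟩ := hcg
    -- the embedding of `c̃ g` is the `c`-partner of that of `g`
    have hcost := structural_comp_algEquiv_comp_complexConj w g
    rw [← hcost] at hm' hnc'
    -- its place is `c •` the place of `τ_w ∘ g`
    rw [ker_residue_restrict_comp_complexConj w τR hτR] at hnc'
    have h2 := hpair (((algebraMap (w.adicCompletion F) (AlgebraicClosure (w.adicCompletion F))).comp
      (algebraMap F (w.adicCompletion F))).comp (g : F →+* F))
    -- case on `m (τ_w ∘ g) ∈ {1, 2}`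
    rcases Nat.lt_or_ge (m (((algebraMap (w.adicCompletion F) (AlgebraicClosure (w.adicCompletion F))).comp
      (algebraMap F (w.adicCompletion F))).comp (g : F →+* F))) 2 with hlt | hge
    · -- `m = 1`: then `τ_w ∘ g` induces `w` or `c•w`; not `c•w` by `hnc`, so `w` — and then the partner induces `c•w`, contradiction with `hnc'`
      have h1 : m (((algebraMap (w.adicCompletion F) (AlgebraicClosure (w.adicCompletion F))).comp
          (algebraMap F (w.adicCompletion F))).comp (g : F →+* F)) = 1 := by omega
      rcases hone _ h1 with hkw | hkcw
      · apply hnc'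
        rw [hkw, HeightOneSpectrum.smul_asIdeal]
      · exact hnc hkcw
    · -- `m = 2`: the partner has `m = 0`, contradiction with `hm'`
      apply hm'
      omega

end HalfType

end Summit.HodgeConjecture.HodgeConjecture.Theorems.F0P6aEmbeddingTorsorPlaces

end
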